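import Mathlib.Algebra.BigOperators.Ring.Finset
import Mathlib.Algebra.Order.BigOperators.Group.Finset
import Mathlib.Algebra.BigOperators.Fin
import Mathlib.Data.Fintype.Pi
import Mathlib.Analysis.SpecialFunctions.Pow.Real
import Mathlib.Tactic.Linarith
import Mathlib.Tactic.Ring
import Mathlib.Tactic.FieldSimp
import HarnessLib

/-!
# The master-family `F`-inequality from its comb form: the tensor-Bernstein (face) expansion

Support file (cell `prim-bnk`, seat bnk-2 gen 20; `--supports stmt-CriticalPhenomena-4575`; memo
`run/shared/lean/prim/prim-l12/FROM-prim-bnk-2-g20-CP-CERTIFICATES.md`, §0 and §7(0)).  No definition, no `sorry`, standard axioms.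

Events on the cube `Fin n → Bool` are Boolean indicator functions `A B G`; a product measure is a parameter vector `p : Fin n → ℝ` with
`0 ≤ p i ≤ 1`, weight `w_p(s) = ∏ i (p i if s i else 1 − p i)`, `μ_p(X) = Σ_s w_p(s)·[X s]`.  The master-family form of `prim-master-conj` is
`F_p(A,B;G) = (1 + μ_pG)·μ_p(ABG) − μ_pG·μ_p(AB) − μ_p(AG)·μ_p(BG)`.

**THEOREM (`F_nonneg_of_face_combs_nonneg`).**  Writing `t = s ⊕ d` (coordinatewise xor),
`F_p = Σ_d Σ_s w_p(s) w_p(s⊕d) φ(s, s⊕d)`, `φ(s,t) = [t∈ABG] + [s∈G][t∈ABG] − [s∈G][t∈AB] − [s∈AG][t∈BG]` (`F_eq_xor_sum`); for fixed `d` the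
weight `w_p(s)w_p(s⊕d)` only depends on `s` off the support of `d`, so `F_p` is a nonnegative combination of the FACE COMB SUMS
`Σ_{s : s∧¬d = z} φ(s, s⊕d)` (= the top tensor-Bernstein coefficient `K` of the triple restricted to the face "coordinates outside `d` frozen
to `z`", antipode = flipping the coordinates in `d`).  Hence: **if every face comb sum is `≥ 0`, then `F_p(A,B;G) ≥ 0` for every product
measure.**  The companion files prove the face comb sums nonnegative for read-once and for threshold third events (`SahiFComb.comb_sum_nonneg_of_readOnce`,
`…_threshold`, after re-indexing a face by `Fin m`), giving `F ≥ 0` for those classes.  HONEST FRAMING: bookkeeping identity + its obvious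
consequence; `F ≥ 0` for general third events remains OPEN. [this work]
-/

namespace Summit.CriticalPhenomena.PercolationContinuityZ3.Theorems

namespace SahiFComb

open Finset

variable {n : ℕ}

/-! ### 1. Product weights -/

/-- Product weights are nonnegative. [folklore] -/
theorem weight_nonneg (p : Fin n → ℝ) (hp0 : ∀ i, 0 ≤ p i) (hp1 : ∀ i, p i ≤ 1) (s : Fin n → Bool) :
    0 ≤ ∏ i, (if s i then p i else 1 - p i) :=
  Finset.prod_nonneg (fun i _ => by by_cases h : s i <;> simp [h, hp0 i, sub_nonneg.mpr (hp1 i)])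

/-- Product weights sum to one. [folklore] -/
theorem sum_weight_eq_one (p : Fin n → ℝ) : ∑ s : Fin n → Bool, ∏ i, (if s i then p i else 1 - p i) = 1 := by
  have h := (Finset.prod_univ_sum (fun (_ : Fin n) => (Finset.univ : Finset Bool)) (fun i b => if b then p i else 1 - p i)).symm
  -- `∏ i, ∑ b, f i b = ∑ s ∈ Fintype.piFinset univ, ∏ i, f i (s i)`
  rw [Fintype.piFinset_univ] at h
  rw [h]
  simp

/-- The weight of `s` times the weight of `s ⊕ d` only depends on `s` through the coordinates outside `d`:
it equals the same product evaluated at the representative `s ∧ ¬d`. [folklore] -/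
theorem weight_mul_weight_xor (p : Fin n → ℝ) (s d : Fin n → Bool) :
    (∏ i, (if s i then p i else 1 - p i)) * (∏ i, (if (xor (s i) (d i)) then p i else 1 - p i))
      = (∏ i, (if (s i && !d i) then p i else 1 - p i)) *
        (∏ i, (if (xor (s i && !d i) (d i)) then p i else 1 - p i)) := by
  rw [← Finset.prod_mul_distrib, ← Finset.prod_mul_distrib]
  refine Finset.prod_congr rfl (fun i _ => ?_)
  cases s i <;> cases d i <;> simp [mul_comm]

/-! ### 2. The xor expansion of `F` -/

/-- Re-indexing a sum by `t ↦ s ⊕ t`. [folklore] -/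
theorem sum_xor_reindex (s : Fin n → Bool) (f : (Fin n → Bool) → ℝ) :
    ∑ t : Fin n → Bool, f t = ∑ d : Fin n → Bool, f (fun i => xor (s i) (d i)) := by
  refine (Fintype.sum_equiv ⟨fun d i => xor (s i) (d i), fun t i => xor (s i) (t i), fun d => ?_, fun t => ?_⟩
    (fun d => f (fun i => xor (s i) (d i))) f (fun d => rfl)).symm
  · funext i; dsimp only; cases s i <;> cases d i <;> rfl
  · funext i; dsimp only; cases s i <;> cases t i <;> rfl

/-- **The xor (face) expansion of `F`.** [this work] -/
theorem F_eq_xor_sum (p : Fin n → ℝ) (A B G : (Fin n → Bool) → Bool) :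
    (1 + ∑ s : Fin n → Bool, (∏ i, (if s i then p i else 1 - p i)) * (Bool.toNat (G s) : ℝ))
        * (∑ s : Fin n → Bool, (∏ i, (if s i then p i else 1 - p i)) * (Bool.toNat (A s && B s && G s) : ℝ))
      - (∑ s : Fin n → Bool, (∏ i, (if s i then p i else 1 - p i)) * (Bool.toNat (G s) : ℝ))
        * (∑ s : Fin n → Bool, (∏ i, (if s i then p i else 1 - p i)) * (Bool.toNat (A s && B s) : ℝ))
      - (∑ s : Fin n → Bool, (∏ i, (if s i then p i else 1 - p i)) * (Bool.toNat (A s && G s) : ℝ))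
        * (∑ s : Fin n → Bool, (∏ i, (if s i then p i else 1 - p i)) * (Bool.toNat (B s && G s) : ℝ))
    = ∑ d : Fin n → Bool, ∑ s : Fin n → Bool,
        ((∏ i, (if s i then p i else 1 - p i)) * (∏ i, (if (xor (s i) (d i)) then p i else 1 - p i)))
        * ( (Bool.toNat (A (fun i => xor (s i) (d i)) && B (fun i => xor (s i) (d i)) && G (fun i => xor (s i) (d i))) : ℝ)
          + (Bool.toNat (G s) : ℝ) * (Bool.toNat (A (fun i => xor (s i) (d i)) && B (fun i => xor (s i) (d i)) && G (fun i => xor (s i) (d i))) : ℝ)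
          - (Bool.toNat (G s) : ℝ) * (Bool.toNat (A (fun i => xor (s i) (d i)) && B (fun i => xor (s i) (d i))) : ℝ)
          - (Bool.toNat (A s && G s) : ℝ) * (Bool.toNat (B (fun i => xor (s i) (d i)) && G (fun i => xor (s i) (d i))) : ℝ) ) := by
  have h1 : (1 : ℝ) = ∑ s : Fin n → Bool, (∏ i, (if s i then p i else 1 - p i)) := (sum_weight_eq_one p).symm
  -- write every product of two sums as a double sum, and the lone sum as a double sum using `Σ w = 1`
  have e1 : (∑ s : Fin n → Bool, (∏ i, (if s i then p i else 1 - p i)) * (Bool.toNat (A s && B s && G s) : ℝ))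
      = ∑ s : Fin n → Bool, ∑ t : Fin n → Bool, (∏ i, (if s i then p i else 1 - p i)) * (∏ i, (if t i then p i else 1 - p i)) * (Bool.toNat (A t && B t && G t) : ℝ) := by
    calc (∑ s : Fin n → Bool, (∏ i, (if s i then p i else 1 - p i)) * (Bool.toNat (A s && B s && G s) : ℝ))
        = (∑ s : Fin n → Bool, (∏ i, (if s i then p i else 1 - p i))) * (∑ t : Fin n → Bool, (∏ i, (if t i then p i else 1 - p i)) * (Bool.toNat (A t && B t && G t) : ℝ)) := by
            rw [← h1, one_mul]
      _ = ∑ s : Fin n → Bool, ∑ t : Fin n → Bool, (∏ i, (if s i then p i else 1 - p i)) * (∏ i, (if t i then p i else 1 - p i)) * (Bool.toNat (A t && B t && G t) : ℝ) := by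
          rw [Finset.sum_mul_sum]; refine Finset.sum_congr rfl (fun s _ => Finset.sum_congr rfl (fun t _ => by ring))
  have e2 : ∀ (X Y : (Fin n → Bool) → Bool),
      (∑ s : Fin n → Bool, (∏ i, (if s i then p i else 1 - p i)) * (Bool.toNat (X s) : ℝ)) * (∑ t : Fin n → Bool, (∏ i, (if t i then p i else 1 - p i)) * (Bool.toNat (Y t) : ℝ))
        = ∑ s : Fin n → Bool, ∑ t : Fin n → Bool, (∏ i, (if s i then p i else 1 - p i)) * (∏ i, (if t i then p i else 1 - p i)) * ((Bool.toNat (X s) : ℝ) * (Bool.toNat (Y t) : ℝ)) := by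
    intro X Y
    rw [Finset.sum_mul_sum]; refine Finset.sum_congr rfl (fun s _ => Finset.sum_congr rfl (fun t _ => by ring))
  have e2a := e2 G (fun s => A s && B s && G s)
  have e2b := e2 G (fun s => A s && B s)
  have e2c := e2 (fun s => A s && G s) (fun s => B s && G s)
  beta_reduce at e2a e2b e2c
  rw [add_mul, one_mul]
  nth_rewrite 1 [e1]
  rw [e2a, e2b, e2c]
  rw [← Finset.sum_add_distrib, ← Finset.sum_sub_distrib, ← Finset.sum_sub_distrib]
  -- now both sides are double sums; re-index the inner sums by xor and swap
  rw [Finset.sum_comm]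
  refine Finset.sum_congr rfl (fun s _ => ?_)
  rw [← Finset.sum_add_distrib, ← Finset.sum_sub_distrib, ← Finset.sum_sub_distrib]
  rw [sum_xor_reindex s]
  refine Finset.sum_congr rfl (fun d _ => ?_)
  ring

/-! ### 3. Grouping by faces -/

/-- For fixed `d`, the xor-summand is a nonnegative combination of face comb sums: if every face comb sum
`Σ_{s : s ∧ ¬d = z} φ(s, s⊕d)` is nonnegative then so is `Σ_s w(s)w(s⊕d)φ(s,s⊕d)`. [this work] -/
theorem xor_slice_nonneg (p : Fin n → ℝ) (hp0 : ∀ i, 0 ≤ p i) (hp1 : ∀ i, p i ≤ 1) (d : Fin n → Bool)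
    (φ : (Fin n → Bool) → ℝ)
    (hface : ∀ z : Fin n → Bool, 0 ≤ ∑ s : Fin n → Bool, (if (fun i => s i && !d i) = z then φ s else 0)) :
    0 ≤ ∑ s : Fin n → Bool,
        ((∏ i, (if s i then p i else 1 - p i)) * (∏ i, (if (xor (s i) (d i)) then p i else 1 - p i))) * φ s := by
  -- replace the weight by its value at the representative `s ∧ ¬d`
  have hrep : ∀ s : Fin n → Bool,
      ((∏ i, (if s i then p i else 1 - p i)) * (∏ i, (if (xor (s i) (d i)) then p i else 1 - p i))) * φ s
        = ∑ z : Fin n → Bool, (if (fun i => s i && !d i) = z then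
            ((∏ i, (if z i then p i else 1 - p i)) * (∏ i, (if (xor (z i) (d i)) then p i else 1 - p i))) * φ s else 0) := by
    intro s
    rw [Finset.sum_ite_eq, if_pos (Finset.mem_univ _), weight_mul_weight_xor p s d]
  rw [Finset.sum_congr rfl (fun s _ => hrep s), Finset.sum_comm]
  refine Finset.sum_nonneg (fun z _ => ?_)
  have hz : ∑ s : Fin n → Bool, (if (fun i => s i && !d i) = z then
        ((∏ i, (if z i then p i else 1 - p i)) * (∏ i, (if (xor (z i) (d i)) then p i else 1 - p i))) * φ s else 0)
      = ((∏ i, (if z i then p i else 1 - p i)) * (∏ i, (if (xor (z i) (d i)) then p i else 1 - p i)))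
        * ∑ s : Fin n → Bool, (if (fun i => s i && !d i) = z then φ s else 0) := by
    rw [Finset.mul_sum]
    refine Finset.sum_congr rfl (fun s _ => ?_)
    split_ifs <;> simp
  rw [hz]
  exact mul_nonneg (mul_nonneg (weight_nonneg p hp0 hp1 z) (weight_nonneg p hp0 hp1 _)) (hface z)

/-- **`F ≥ 0` from the nonnegativity of all face comb sums.**  If for every `d` (free coordinates) and every `z` (frozen values, zero on the
free coordinates) the comb sum of the face is nonnegative, then `F_p(A,B;G) ≥ 0` for every product measure `p`. [this work] -/
theorem F_nonneg_of_face_combs_nonneg (p : Fin n → ℝ) (hp0 : ∀ i, 0 ≤ p i) (hp1 : ∀ i, p i ≤ 1)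
    (A B G : (Fin n → Bool) → Bool)
    (hface : ∀ d z : Fin n → Bool, 0 ≤ ∑ s : Fin n → Bool, (if (fun i => s i && !d i) = z then
        ( (Bool.toNat (A (fun i => xor (s i) (d i)) && B (fun i => xor (s i) (d i)) && G (fun i => xor (s i) (d i))) : ℝ)
          + (Bool.toNat (G s) : ℝ) * (Bool.toNat (A (fun i => xor (s i) (d i)) && B (fun i => xor (s i) (d i)) && G (fun i => xor (s i) (d i))) : ℝ)
          - (Bool.toNat (G s) : ℝ) * (Bool.toNat (A (fun i => xor (s i) (d i)) && B (fun i => xor (s i) (d i))) : ℝ)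
          - (Bool.toNat (A s && G s) : ℝ) * (Bool.toNat (B (fun i => xor (s i) (d i)) && G (fun i => xor (s i) (d i))) : ℝ) )
        else 0)) :
    0 ≤ (1 + ∑ s : Fin n → Bool, (∏ i, (if s i then p i else 1 - p i)) * (Bool.toNat (G s) : ℝ))
        * (∑ s : Fin n → Bool, (∏ i, (if s i then p i else 1 - p i)) * (Bool.toNat (A s && B s && G s) : ℝ))
      - (∑ s : Fin n → Bool, (∏ i, (if s i then p i else 1 - p i)) * (Bool.toNat (G s) : ℝ))
        * (∑ s : Fin n → Bool, (∏ i, (if s i then p i else 1 - p i)) * (Bool.toNat (A s && B s) : ℝ))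
      - (∑ s : Fin n → Bool, (∏ i, (if s i then p i else 1 - p i)) * (Bool.toNat (A s && G s) : ℝ))
        * (∑ s : Fin n → Bool, (∏ i, (if s i then p i else 1 - p i)) * (Bool.toNat (B s && G s) : ℝ)) := by
  rw [F_eq_xor_sum]
  exact Finset.sum_nonneg (fun d _ => xor_slice_nonneg p hp0 hp1 d _ (hface d))

end SahiFComb

end Summit.CriticalPhenomena.PercolationContinuityZ3.Theorems
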